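import Literature.NumberTheory.Transcendental.FormsAlgebraWedgeProofs
import HarnessLib

/-!
# The wedge of a `1`-form and a `2`-form evaluated on three vectors

A pointwise evaluation formula for the tree's shuffle wedge product
(`ContinuousAlternatingMap.wedge`, `Literature/NumberTheory/Transcendental/FormsAlgebra.lean`,
Warner's normalisation `(k! l!)⁻¹ ∑_σ sign σ …`), degree `(1, 2)`, real coefficients:

  `(α ∧ β)(v₀, v₁, v₂) = α(v₀) β(v₁, v₂) - α(v₁) β(v₀, v₂) + α(v₂) β(v₀, v₁)`

(`wedge_apply_one_two`; Warner (1983), 2.10(b) with `k = 1`, `l = 2` — the companion of the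
tree's `wedge_apply_one_one`).  Written for the fact seat of
`Literature.Geometry.Symplectic.mclean_divisorComplement_convex_four` (McLean 2012, Lemma 5.17:
the cut-off Stokes computation of the sign of the wrapping number evaluates `dχ ∧ (θ ∧ ω)` on a
frame through the rotation vector).  Proof: the first-slot expansion of the alternating sum
(`sum_perm_sign_smul_comp_eq_sum_cons`) and the two permutations of `Fin 2`.

Everything is proved; no definitions, no named facts (D-0026).

## References

* F. W. Warner, *Foundations of Differentiable Manifolds and Lie Groups* (1983), 2.10(b).
  [Warner1983]
-/

noncomputable section

open Literature.NumberTheory.Transcendental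

namespace ContinuousAlternatingMap

variable {V : Type*} [NormedAddCommGroup V] [NormedSpace ℝ V]

/-- The alternating sum over the two permutations of `Fin 2`. [folklore] -/
private theorem sum_perm_fin_two_sign_smul {N : Type*} [AddCommGroup N]
    (f : Equiv.Perm (Fin 2) → N) :
    ∑ e : Equiv.Perm (Fin 2), (Equiv.Perm.sign e : ℤ) • f e = f 1 - f (Equiv.swap 0 1) := by
  have huniv : (Finset.univ : Finset (Equiv.Perm (Fin 2))) = {1, Equiv.swap 0 1} := by decide
  rw [huniv, Finset.sum_pair (by decide), Equiv.Perm.sign_one, Equiv.Perm.sign_swap (by decide)]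
  simp [sub_eq_add_neg]

omit [NormedAddCommGroup V] [NormedSpace ℝ V] in
/-- `Fin.removeNth` on triples. [folklore] -/
private theorem removeNth_zero_three' (a b c : V) :
    (0 : Fin 3).removeNth (![a, b, c] : Fin 3 → V) = ![b, c] := by
  funext i; fin_cases i <;> rfl

omit [NormedAddCommGroup V] [NormedSpace ℝ V] in
/-- `Fin.removeNth` on triples. [folklore] -/
private theorem removeNth_one_three' (a b c : V) :
    (1 : Fin 3).removeNth (![a, b, c] : Fin 3 → V) = ![a, c] := by
  funext i; fin_cases i <;> rfl

omit [NormedAddCommGroup V] [NormedSpace ℝ V] in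
/-- `Fin.removeNth` on triples. [folklore] -/
private theorem removeNth_two_three' (a b c : V) :
    (2 : Fin 3).removeNth (![a, b, c] : Fin 3 → V) = ![a, b] := by
  funext i; fin_cases i <;> rfl

/-- **The wedge of a `1`-form and a `2`-form on three vectors** (Warner (1983), 2.10(b),
`k = 1`, `l = 2`, real coefficients):
`(α ∧ β)(v₀, v₁, v₂) = α(v₀) β(v₁, v₂) - α(v₁) β(v₀, v₂) + α(v₂) β(v₀, v₁)`. [cite: Warner1983] -/
theorem wedge_apply_one_two (α : V [⋀^Fin 1]→L[ℝ] ℝ) (β : V [⋀^Fin 2]→L[ℝ] ℝ) (a b c : V) :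
    α.wedge β ![a, b, c] =
      α ![a] * β ![b, c] - α ![b] * β ![a, c] + α ![c] * β ![a, b] := by
  -- the shuffle sum as an alternating sum of `f (v ∘ σ)`
  set f : (Fin (2 + 1) → V) → ℝ := fun z ↦ α ![z 0] * β ![z 1, z 2] with hf
  have h1 : α.wedge β ![a, b, c] = ((Nat.factorial 1 * Nat.factorial 2 : ℕ) : ℝ)⁻¹ •
      ∑ σ : Equiv.Perm (Fin (2 + 1)), (Equiv.Perm.sign σ : ℤ) • f (![a, b, c] ∘ σ) := by
    rw [wedge_apply_zsmul]
    congr 1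
    refine Fintype.sum_equiv (Equiv.refl _) _ _ fun σ ↦ ?_
    simp only [Equiv.refl_apply, hf, Function.comp_apply]
    congr 2
    · congr 1
      funext i; fin_cases i; rfl
    · congr 1
      funext j; fin_cases j <;> rfl
  rw [h1, sum_perm_sign_smul_comp_eq_sum_cons, Fin.sum_univ_three]
  simp only [sum_perm_fin_two_sign_smul, hf, Fin.cons_zero]
  -- evaluate the tuples
  have hsw2 : ∀ p q : V, ((![p, q] : Fin 2 → V) ∘ (Equiv.swap (0 : Fin 2) 1)) = ![q, p] :=
    fun p q ↦ by funext i; fin_cases i <;> rfl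
  have hid2 : ∀ p q : V, ((![p, q] : Fin 2 → V) ∘ (1 : Equiv.Perm (Fin 2))) = ![p, q] :=
    fun p q ↦ by funext i; rfl
  have hc1 : ∀ x p q : V, (Fin.cons x (![p, q] : Fin 2 → V) : Fin 3 → V) 1 = p := fun x p q ↦ rfl
  have hc2 : ∀ x p q : V, (Fin.cons x (![p, q] : Fin 2 → V) : Fin 3 → V) 2 = q := fun x p q ↦ rfl
  have hv0 : (![a, b, c] : Fin 3 → V) 0 = a := rfl
  have hv1 : (![a, b, c] : Fin 3 → V) 1 = b := rfl
  have hv2 : (![a, b, c] : Fin 3 → V) 2 = c := rfl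
  simp only [removeNth_zero_three', removeNth_one_three', removeNth_two_three', hsw2, hid2, hc1,
    hc2, hv0, hv1, hv2]
  -- antisymmetry of `β` on the swapped pairs
  have hsw : ∀ p q : V, β ![q, p] = -β ![p, q] := fun p q ↦ by
    have h := β.map_swap ![p, q] (i := 0) (j := 1) (by decide)
    rw [hsw2] at h
    exact h
  rw [hsw b c, hsw a c, hsw a b]
  -- scalars
  simp only [Fin.val_zero, Fin.val_one, Fin.val_two, pow_zero, pow_one, one_smul, neg_smul,
    even_two.neg_pow, one_pow, Nat.factorial_one, Nat.factorial_two, one_mul, Nat.cast_ofNat,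
    smul_eq_mul]
  ring

end ContinuousAlternatingMap
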